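import Summits.AtomisticToContinuum.FouriersLaw.Theorems.HiddenChargeMazurThomsonBoundGibbsCalculus
import Mathlib.Analysis.Calculus.BumpFunction.FiniteDimension
import Mathlib.MeasureTheory.Integral.DominatedConvergence

/-!
# The bath (Ornstein–Uhlenbeck) part of the generator against the `e^{θH}` class (Thomson bound, part C)

Helper file (`--supports stmt-AtomisticToContinuum-13512`, decl `HiddenChargeMazur.ThomsonBound`).
For the pinned anharmonic chain `pinnedChain ω₂ lam β γ` (`ω₂ > 0`, `lam, β ≥ 0`), `T > 0` and
`ρ = e^{-H/T}`: the bath part `K = ∑_{b ∈ {0, N-1}} (T ∂²_{p_b}F - p_b ∂_{p_b}F)` of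
`OscillatorChain.generator N T T` satisfies, for `F ∈ C²` and `G ∈ C¹` in the growth class of the
item (`|∂_pF|, |G|, |∂_pG| ≤ C e^{θH}`, `θ < 1/(2T)`) and PROVIDED `K G ρ ∈ L¹`,
`∫ K G ρ = -T ∑_b ∫ ∂_{p_b}F ∂_{p_b}G ρ` (`integral_bathSum_mul_eq`).

The point is that the item's growth class controls first derivatives only, so `∂²_{p_b}F · G ρ`
need not be integrable site by site; we integrate by parts against the compactly supported test
functions `G χ_n` (`integral_bathSite_mul_of_hasCompactSupport`), with smooth cutoffs
`χ_n → 1`, `|∂χ_n| ≤ M/(n+1)` (`exists_cutoff`, a scaled `ContDiffBump`), and remove the cutoff by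
dominated convergence (`tendsto_integral_bathSite_mul_cutoff`).
[Bonetto–Lebowitz–Rey-Bellet 2000, §4.1; Cuneo–Eckmann–Hairer–Rey-Bellet 2018, §3.1]
-/

noncomputable section

open MeasureTheory Filter Topology

namespace Summit.AtomisticToContinuum.FouriersLaw.Theorems.ThomsonBound

open Literature.MathematicalPhysics.KineticTheory.HeatConduction
open Summit.AtomisticToContinuum.FouriersLaw.Theorems.SubdiffusiveBondHeat
  (integral_mul_eq_neg_of_hasLineDerivAt_of_integrable)

variable {N : ℕ}

/-! ### Smooth cutoffs exhausting phase space -/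

/-- **Smooth cutoffs exhausting phase space.** There is a sequence `χ_n ∈ C²_c(PhaseSpace N)` with
`0 ≤ χ_n ≤ 1`, `χ_n(z) = 1` eventually for every `z`, and `|∂_{p_i} χ_n| ≤ M/(n+1)` uniformly
(`χ_n(z) = χ(z/(n+1))` for a fixed smooth bump `χ`, `= 1` on the unit ball, supported in the ball
of radius `2`; `∂χ_n = (n+1)⁻¹ (∂χ)(·/(n+1))` and `∂χ` is bounded). [folklore] -/
theorem exists_cutoff (N : ℕ) : ∃ χ : ℕ → PhaseSpace N → ℝ,
    (∀ n, ContDiff ℝ 2 (χ n)) ∧ (∀ n, HasCompactSupport (χ n)) ∧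
    (∀ n z, 0 ≤ χ n z) ∧ (∀ n z, χ n z ≤ 1) ∧
    (∀ z, ∀ᶠ n in atTop, χ n z = 1) ∧
    ∃ M, ∀ n z (i : Fin N), |partialP i (χ n) z| ≤ M / (n + 1) := by
  let b : ContDiffBump (0 : PhaseSpace N) := ⟨1, 2, one_pos, one_lt_two⟩
  obtain ⟨M, hM⟩ : ∃ M, ∀ x, ‖fderiv ℝ (b : PhaseSpace N → ℝ) x‖ ≤ M :=
    ((b.contDiff (n := 1)).continuous_fderiv one_ne_zero).bounded_above_of_compact_support
      (b.hasCompactSupport.fderiv (𝕜 := ℝ))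
  refine ⟨fun n z => b (((n : ℝ) + 1)⁻¹ • z), fun n => ?_, fun n => ?_, fun n z => b.nonneg,
    fun n z => b.le_one, fun z => ?_, ⟨M, fun n z i => ?_⟩⟩
  · exact (b.contDiff (n := 2)).comp (contDiff_const_smul _)
  · exact b.hasCompactSupport.comp_smul (inv_ne_zero (by positivity))
  · refine eventually_atTop.2 ⟨⌈‖z‖⌉₊, fun n hn => ?_⟩
    apply b.one_of_mem_closedBall
    rw [Metric.mem_closedBall, dist_zero_right, norm_smul, Real.norm_eq_abs,
      abs_of_pos (by positivity)]
    have h1 : ‖z‖ ≤ (n : ℝ) + 1 := by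
      have := Nat.le_ceil ‖z‖
      have h2 : (⌈‖z‖⌉₊ : ℝ) ≤ n := by exact_mod_cast hn
      linarith
    have hn1 : (0 : ℝ) < (n : ℝ) + 1 := by positivity
    calc ((n : ℝ) + 1)⁻¹ * ‖z‖ ≤ ((n : ℝ) + 1)⁻¹ * ((n : ℝ) + 1) := by gcongr
      _ = b.rIn := by rw [inv_mul_cancel₀ hn1.ne']
  · set c : ℝ := ((n : ℝ) + 1)⁻¹ with hc
    have hc0 : 0 < c := by positivity
    set v : PhaseSpace N := (0, Pi.single i 1) with hv
    have hf : HasDerivAt (fun t : ℝ => c • (z + t • v)) (c • v) 0 := by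
      have h1 : HasDerivAt (fun t : ℝ => z + t • v) v 0 := by
        simpa using ((hasDerivAt_id (0 : ℝ)).smul_const v).const_add z
      exact h1.const_smul c
    have h2 : HasFDerivAt (b : PhaseSpace N → ℝ) (fderiv ℝ (b : PhaseSpace N → ℝ) (c • z)) (c • z) :=
      ((b.contDiff (n := 1)).differentiable one_ne_zero (c • z)).hasFDerivAt
    have h3 : HasLineDerivAt ℝ (fun y : PhaseSpace N => b (c • y))
        (fderiv ℝ (b : PhaseSpace N → ℝ) (c • z) (c • v)) z v := by
      unfold HasLineDerivAt
      exact h2.comp_hasDerivAt_of_eq 0 hf (by simp)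
    rw [partialP_eq_lineDeriv, ← hv, h3.lineDeriv, map_smul, smul_eq_mul]
    have hvn : ‖v‖ ≤ 1 := by
      rw [hv, Prod.norm_def]
      simp [Pi.norm_single]
    have h4 : |fderiv ℝ (b : PhaseSpace N → ℝ) (c • z) v| ≤ M := by
      rw [← Real.norm_eq_abs]
      calc ‖fderiv ℝ (b : PhaseSpace N → ℝ) (c • z) v‖
          ≤ ‖fderiv ℝ (b : PhaseSpace N → ℝ) (c • z)‖ * ‖v‖ := ContinuousLinearMap.le_opNorm _ _
        _ ≤ M * 1 := mul_le_mul (hM _) hvn (norm_nonneg _) ((norm_nonneg _).trans (hM (c • z)))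
        _ = M := mul_one M
    rw [abs_mul, abs_of_pos hc0, hc, div_eq_inv_mul]
    exact mul_le_mul_of_nonneg_left h4 (by positivity)

/-- `∂_{p_b} (G χ) = (∂_{p_b} G) χ + G ∂_{p_b} χ` for differentiable `G, χ`. [folklore] -/
theorem partialP_mul {G χ : PhaseSpace N → ℝ} (hG : Differentiable ℝ G) (hχ : Differentiable ℝ χ)
    (b : Fin N) :
    partialP b (fun y => G y * χ y) = fun x => partialP b G x * χ x + G x * partialP b χ x := by
  funext x
  rw [partialP_eq_lineDeriv]
  exact (hasLineDerivAt_mul (hasLineDerivAt_partialP hG b x)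
    (hasLineDerivAt_partialP hχ b x)).lineDeriv

section Pinned

variable {ω₂ lam β : ℝ}

/-! ### The bath term against a compactly supported test function -/

/-- **Ornstein–Uhlenbeck part against a `C¹_c` test function.** For `F ∈ C²` (no growth condition)
and `φ ∈ C¹_c`: `∫ (T ∂²_{p_b}F - p_b ∂_{p_b}F) φ e^{-H/T} = -T ∫ ∂_{p_b}F ∂_{p_b}φ e^{-H/T}`
(one integration by parts in `p_b`, `∂_{p_b} e^{-H/T} = -(p_b/T) e^{-H/T}`; all integrands are
continuous with compact support). [Cuneo–Eckmann–Hairer–Rey-Bellet 2018, §3.1] [folklore] -/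
theorem integral_bathSite_mul_of_hasCompactSupport (ω₂ lam β γ : ℝ) (N : ℕ) {T : ℝ} (hT : 0 < T)
    {F φ : PhaseSpace N → ℝ} (hF : ContDiff ℝ 2 F) (hφ : ContDiff ℝ 1 φ)
    (hφc : HasCompactSupport φ) (b : Fin N) :
    ∫ x, (T * partialP b (partialP b F) x - x.2 b * partialP b F x) * φ x *
        (pinnedChain ω₂ lam β γ).gibbsDensity N T x =
      -T * ∫ x, partialP b F x * partialP b φ x * (pinnedChain ω₂ lam β γ).gibbsDensity N T x := by
  set P := pinnedChain ω₂ lam β γ with hP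
  have hρc : Continuous (P.gibbsDensity N T) := pinnedChain_continuous_gibbsDensity ω₂ lam β γ N T
  have hF1 : ContDiff ℝ 1 (partialP b F) := contDiff_partialP hF (by norm_num) b
  have hFd : Differentiable ℝ (partialP b F) := hF1.differentiable one_ne_zero
  have hF'c : Continuous (partialP b F) := hF1.continuous
  have hF''c : Continuous (partialP b (partialP b F)) := continuous_partialP hF1 one_ne_zero b
  have hφd : Differentiable ℝ φ := hφ.differentiable one_ne_zero
  have hφ'c : Continuous (partialP b φ) := continuous_partialP hφ one_ne_zero b
  have hφ's : HasCompactSupport (partialP b φ) := hasCompactSupport_partialP hφd hφc b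
  -- the three compactly supported integrands
  have I1 : Integrable fun x => φ x * P.gibbsDensity N T x * partialP b (partialP b F) x :=
    ((hφ.continuous.mul hρc).mul hF''c).integrable_of_hasCompactSupport
      (hφc.mul_right.mul_right)
  have I2 : Integrable fun x => partialP b φ x * P.gibbsDensity N T x * partialP b F x :=
    ((hφ'c.mul hρc).mul hF'c).integrable_of_hasCompactSupport (hφ's.mul_right.mul_right)
  have I3 : Integrable fun x => φ x * (x.2 b * P.gibbsDensity N T x * partialP b F x) :=
    (hφ.continuous.mul (((by fun_prop : Continuous fun x : PhaseSpace N => x.2 b).mul hρc).mul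
      hF'c)).integrable_of_hasCompactSupport hφc.mul_right
  have e := integral_mul_eq_neg_of_hasLineDerivAt_of_integrable
    (F := fun x => φ x * P.gibbsDensity N T x)
    (F' := fun x => partialP b φ x * P.gibbsDensity N T x + φ x * (-(x.2 b / T) * P.gibbsDensity N T x))
    (g := partialP b F) (g' := partialP b (partialP b F)) (v := ((0, Pi.single b 1) : PhaseSpace N))
    ?_ I1 ?_ ?_ ?_
  · -- rearrange
    have e2 : ∫ x, (partialP b φ x * P.gibbsDensity N T x + φ x * (-(x.2 b / T) *
        P.gibbsDensity N T x)) * partialP b F x =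
        (∫ x, partialP b φ x * P.gibbsDensity N T x * partialP b F x) -
          T⁻¹ * ∫ x, φ x * (x.2 b * P.gibbsDensity N T x * partialP b F x) := by
      rw [← integral_const_mul, ← integral_sub I2 (I3.const_mul _)]
      refine integral_congr_ae (Filter.Eventually.of_forall fun x => ?_)
      simp only
      ring
    have lhs : ∫ x, (T * partialP b (partialP b F) x - x.2 b * partialP b F x) * φ x *
        P.gibbsDensity N T x =
        T * (∫ x, φ x * P.gibbsDensity N T x * partialP b (partialP b F) x) -
          ∫ x, φ x * (x.2 b * P.gibbsDensity N T x * partialP b F x) := by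
      rw [← integral_const_mul, ← integral_sub (I1.const_mul T) I3]
      refine integral_congr_ae (Filter.Eventually.of_forall fun x => ?_)
      simp only
      ring
    have hI : ∫ x, partialP b F x * partialP b φ x * P.gibbsDensity N T x =
        ∫ x, partialP b φ x * P.gibbsDensity N T x * partialP b F x :=
      integral_congr_ae (Filter.Eventually.of_forall fun x => by simp only; ring)
    rw [lhs, e, e2, hI, neg_sub, mul_sub, ← mul_assoc, mul_inv_cancel₀ hT.ne', one_mul]
    ring
  · refine (I2.add (I3.const_mul (-T⁻¹))).congr (Filter.Eventually.of_forall fun x => ?_)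
    simp only [Pi.add_apply]
    ring
  · exact ((hφ.continuous.mul hρc).mul hF'c).integrable_of_hasCompactSupport
      (hφc.mul_right.mul_right)
  · intro x
    exact hasLineDerivAt_mul (hasLineDerivAt_partialP hφd b x)
      (P.hasLineDerivAt_gibbsDensity (P.hasLineDerivAt_hamiltonian_unitP N x b))
  · exact fun x => hasLineDerivAt_partialP hFd b x

/-! ### Removing the cutoff: the bath term against the growth class -/

/-- **One bath site against the growth class, by cutoff.** For `F ∈ C²` with
`|∂_{p_b}F| ≤ C_F e^{θH}`, `G ∈ C¹` with `|G|, |∂_{p_b}G| ≤ C_G e^{θH}`, `θ < 1/(2T)`, and cutoffs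
`χ_n` as in `exists_cutoff`:
`∫ (T ∂²_{p_b}F - p_b ∂_{p_b}F) (G χ_n) e^{-H/T} → -T ∫ ∂_{p_b}F ∂_{p_b}G e^{-H/T}` (dominated
convergence; the second derivative of `F` is never integrated against `G` itself). [folklore] -/
theorem tendsto_integral_bathSite_mul_cutoff (hω : 0 < ω₂) (hl : 0 ≤ lam) (hβ : 0 ≤ β) (γ : ℝ)
    (N : ℕ) {T θ : ℝ} (hT : 0 < T) (hθ : θ < 1 / (2 * T)) (b : Fin N)
    {F G : PhaseSpace N → ℝ} (hF : ContDiff ℝ 2 F) (hG : ContDiff ℝ 1 G) {CF CG : ℝ}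
    (hFp : ∀ x, |partialP b F x| ≤ CF * Real.exp (θ * (pinnedChain ω₂ lam β γ).hamiltonian N x))
    (hGle : ∀ x, |G x| ≤ CG * Real.exp (θ * (pinnedChain ω₂ lam β γ).hamiltonian N x))
    (hGp : ∀ x, |partialP b G x| ≤ CG * Real.exp (θ * (pinnedChain ω₂ lam β γ).hamiltonian N x))
    {χ : ℕ → PhaseSpace N → ℝ} (hχ1 : ∀ n, ContDiff ℝ 2 (χ n))
    (hχ2 : ∀ n, HasCompactSupport (χ n)) (hχ3 : ∀ n z, 0 ≤ χ n z) (hχ4 : ∀ n z, χ n z ≤ 1)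
    (hχ5 : ∀ z, ∀ᶠ n in atTop, χ n z = 1) {M : ℝ}
    (hχ6 : ∀ n z (i : Fin N), |partialP i (χ n) z| ≤ M / (n + 1)) :
    Tendsto (fun n => ∫ x, (T * partialP b (partialP b F) x - x.2 b * partialP b F x) *
        (G x * χ n x) * (pinnedChain ω₂ lam β γ).gibbsDensity N T x) atTop
      (𝓝 (-T * ∫ x, partialP b F x * partialP b G x *
        (pinnedChain ω₂ lam β γ).gibbsDensity N T x)) := by
  set P := pinnedChain ω₂ lam β γ with hP
  have h2θ : 2 * θ < 1 / T := by
    have h := (lt_div_iff₀ (by positivity : (0:ℝ) < 2 * T)).mp hθ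
    rw [lt_div_iff₀ hT]; linarith
  have hρc : Continuous (P.gibbsDensity N T) := pinnedChain_continuous_gibbsDensity ω₂ lam β γ N T
  have hGd : Differentiable ℝ G := hG.differentiable one_ne_zero
  have hχd : ∀ n, Differentiable ℝ (χ n) := fun n => (hχ1 n).differentiable two_ne_zero
  have hF1 : ContDiff ℝ 1 (partialP b F) := contDiff_partialP hF (by norm_num) b
  have hF'c : Continuous (partialP b F) := hF1.continuous
  have hG'c : Continuous (partialP b G) := continuous_partialP hG one_ne_zero b
  have hχ'c : ∀ n, Continuous (partialP b (χ n)) := fun n =>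
    continuous_partialP (hχ1 n) two_ne_zero b
  have hM0 : 0 ≤ M := by
    have h := (abs_nonneg _).trans (hχ6 0 0 b)
    simpa using h
  -- rewrite each term with the compactly supported test function `G χ_n`
  have e : ∀ n, ∫ x, (T * partialP b (partialP b F) x - x.2 b * partialP b F x) * (G x * χ n x) *
      P.gibbsDensity N T x =
      -T * ∫ x, partialP b F x * (partialP b G x * χ n x + G x * partialP b (χ n) x) *
        P.gibbsDensity N T x := by
    intro n
    have h := integral_bathSite_mul_of_hasCompactSupport ω₂ lam β γ N hT hF
      (hG.mul ((hχ1 n).of_le (by norm_num))) ((hχ2 n).mul_left) b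
    simp only [partialP_mul hGd (hχd n) b] at h
    exact h
  simp_rw [e]
  refine Tendsto.const_mul (-T) ?_
  -- dominated convergence
  have IA : Integrable fun x => partialP b F x * partialP b G x * P.gibbsDensity N T x :=
    integrable_mul_gibbsDensity_of_le_exp hω hl hβ γ N hT h2θ 0 (hF'c.mul hG'c) (C := CF * CG)
      fun x => by
        have h := abs_mul_le_of_le_exp (m := 0) (A := CF) (by simpa using hFp x) (hGp x)
        simpa using h
  have IB : Integrable fun x => partialP b F x * G x * P.gibbsDensity N T x :=
    integrable_mul_gibbsDensity_of_le_exp hω hl hβ γ N hT h2θ 0 (hF'c.mul hG.continuous)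
      (C := CF * CG) fun x => by
        have h := abs_mul_le_of_le_exp (m := 0) (A := CF) (by simpa using hFp x) (hGle x)
        simpa using h
  refine tendsto_integral_of_dominated_convergence
    (fun x => |partialP b F x * partialP b G x * P.gibbsDensity N T x| +
      M * |partialP b F x * G x * P.gibbsDensity N T x|) (fun n => ?_) (IA.abs.add (IB.abs.const_mul M))
    (fun n => Filter.Eventually.of_forall fun x => ?_) (Filter.Eventually.of_forall fun x => ?_)
  · exact ((hF'c.mul ((hG'c.mul (hχ1 n).continuous).add (hG.continuous.mul (hχ'c n)))).mul
      hρc).aestronglyMeasurable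
  · have hρ : 0 < P.gibbsDensity N T x := P.gibbsDensity_pos N T x
    have hχa : |χ n x| ≤ 1 := abs_le.2 ⟨by linarith [hχ3 n x], hχ4 n x⟩
    have hχ'a : |partialP b (χ n) x| ≤ M := by
      refine (hχ6 n x b).trans (div_le_self hM0 ?_)
      have : (0:ℝ) ≤ n := Nat.cast_nonneg n
      linarith
    rw [Real.norm_eq_abs, mul_add, add_mul]
    refine (abs_add_le _ _).trans (add_le_add ?_ ?_)
    · have : partialP b F x * (partialP b G x * χ n x) * P.gibbsDensity N T x =
          (partialP b F x * partialP b G x * P.gibbsDensity N T x) * χ n x := by ring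
      rw [this, abs_mul]
      exact (mul_le_mul_of_nonneg_left hχa (abs_nonneg _)).trans (le_of_eq (mul_one _))
    · have : partialP b F x * (G x * partialP b (χ n) x) * P.gibbsDensity N T x =
          (partialP b F x * G x * P.gibbsDensity N T x) * partialP b (χ n) x := by ring
      rw [this, abs_mul, mul_comm M]
      exact mul_le_mul_of_nonneg_left hχ'a (abs_nonneg _)
  · have h1 : Tendsto (fun n => χ n x) atTop (𝓝 1) :=
      tendsto_const_nhds.congr' ((hχ5 x).mono fun n hn => hn.symm)
    have h2 : Tendsto (fun n => partialP b (χ n) x) atTop (𝓝 0) := by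
      have h0 : Tendsto (fun n : ℕ => M / ((n : ℝ) + 1)) atTop (𝓝 0) := by
        have h := (tendsto_one_div_add_atTop_nhds_zero_nat (𝕜 := ℝ)).const_mul M
        rw [mul_zero] at h
        exact h.congr fun n => by ring
      refine squeeze_zero_norm (fun n => ?_) h0
      rw [Real.norm_eq_abs]
      exact hχ6 n x b
    have h3 := ((h1.const_mul (partialP b G x)).add (h2.const_mul (G x))).const_mul
      (partialP b F x) |>.mul_const (P.gibbsDensity N T x)
    simpa using h3

/-- **The bath part of the generator against the growth class.** For `F ∈ C²` with
`|∂_{p_i}F| ≤ C_F e^{θH}`, `G ∈ C¹` with `|G|, |∂_{p_i}G| ≤ C_G e^{θH}`, `θ < 1/(2T)`, and the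
two-bath sum `K = ∑_i ([i = 0] + [i = N-1]) (T ∂²_{p_i}F - p_i ∂_{p_i}F)` (the bath part of
`OscillatorChain.generator` at `T_L = T_R = T`, without the factor `γ`), ASSUMING `K G e^{-H/T}`
integrable (in the application `γ K = -J - A F`):
`∫ K G e^{-H/T} = -T ∑_i ([i = 0] + [i = N-1]) ∫ ∂_{p_i}F ∂_{p_i}G e^{-H/T}`.
[Bonetto–Lebowitz–Rey-Bellet 2000, §4.1; Cuneo–Eckmann–Hairer–Rey-Bellet 2018, §3.1] [folklore] -/
theorem integral_bathSum_mul_eq (hω : 0 < ω₂) (hl : 0 ≤ lam) (hβ : 0 ≤ β) (γ : ℝ)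
    (N : ℕ) {T θ : ℝ} (hT : 0 < T) (hθ : θ < 1 / (2 * T))
    {F G : PhaseSpace N → ℝ} (hF : ContDiff ℝ 2 F) (hG : ContDiff ℝ 1 G) {CF CG : ℝ}
    (hFp : ∀ x i, |partialP i F x| ≤ CF * Real.exp (θ * (pinnedChain ω₂ lam β γ).hamiltonian N x))
    (hGle : ∀ x, |G x| ≤ CG * Real.exp (θ * (pinnedChain ω₂ lam β γ).hamiltonian N x))
    (hGp : ∀ x i, |partialP i G x| ≤ CG * Real.exp (θ * (pinnedChain ω₂ lam β γ).hamiltonian N x))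
    (hK : Integrable fun x => (∑ i : Fin N,
      ((if i.val = 0 then T * partialP i (partialP i F) x - x.2 i * partialP i F x else 0) +
        (if i.val = N - 1 then T * partialP i (partialP i F) x - x.2 i * partialP i F x else 0))) *
      G x * (pinnedChain ω₂ lam β γ).gibbsDensity N T x) :
    ∫ x, (∑ i : Fin N,
      ((if i.val = 0 then T * partialP i (partialP i F) x - x.2 i * partialP i F x else 0) +
        (if i.val = N - 1 then T * partialP i (partialP i F) x - x.2 i * partialP i F x else 0))) *
      G x * (pinnedChain ω₂ lam β γ).gibbsDensity N T x =
      -T * ∑ i : Fin N,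
        ((if i.val = 0 then ∫ x, partialP i F x * partialP i G x *
            (pinnedChain ω₂ lam β γ).gibbsDensity N T x else 0) +
          (if i.val = N - 1 then ∫ x, partialP i F x * partialP i G x *
            (pinnedChain ω₂ lam β γ).gibbsDensity N T x else 0)) := by
  set P := pinnedChain ω₂ lam β γ with hP
  obtain ⟨χ, hχ1, hχ2, hχ3, hχ4, hχ5, M, hχ6⟩ := exists_cutoff N
  have hρc : Continuous (P.gibbsDensity N T) := pinnedChain_continuous_gibbsDensity ω₂ lam β γ N T
  have hF1 : ∀ i, ContDiff ℝ 1 (partialP i F) := fun i => contDiff_partialP hF (by norm_num) i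
  have hSc : ∀ i, Continuous fun x : PhaseSpace N =>
      T * partialP i (partialP i F) x - x.2 i * partialP i F x := fun i =>
    (continuous_const.mul (continuous_partialP (hF1 i) one_ne_zero i)).sub
      ((by fun_prop : Continuous fun x : PhaseSpace N => x.2 i).mul (hF1 i).continuous)
  -- Step 1: with the cutoff, the integral of the sum is the sum of the site integrals
  have Isite : ∀ (n : ℕ) (i : Fin N) (c : Prop) [Decidable c], Integrable fun x =>
      (if c then T * partialP i (partialP i F) x - x.2 i * partialP i F x else 0) *
        (G x * χ n x) * P.gibbsDensity N T x := by
    intro n i c _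
    by_cases hc : c
    · simp only [hc, if_true]
      exact (((hSc i).mul (hG.continuous.mul (hχ1 n).continuous)).mul
        hρc).integrable_of_hasCompactSupport ((hχ2 n).mul_left.mul_left.mul_right)
    · simp only [hc, if_false, zero_mul]
      exact integrable_zero _ _ _
  have Vsite : ∀ (n : ℕ) (i : Fin N) (c : Prop) [Decidable c], ∫ x,
      (if c then T * partialP i (partialP i F) x - x.2 i * partialP i F x else 0) *
        (G x * χ n x) * P.gibbsDensity N T x =
      if c then ∫ x, (T * partialP i (partialP i F) x - x.2 i * partialP i F x) *
        (G x * χ n x) * P.gibbsDensity N T x else 0 := by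
    intro n i c _
    by_cases hc : c
    · simp only [hc, if_true]
    · simp only [hc, if_false, zero_mul, integral_zero]
  have key : ∀ n, ∫ x, (∑ i : Fin N,
      ((if i.val = 0 then T * partialP i (partialP i F) x - x.2 i * partialP i F x else 0) +
        (if i.val = N - 1 then T * partialP i (partialP i F) x - x.2 i * partialP i F x else 0))) *
      (G x * χ n x) * P.gibbsDensity N T x =
      ∑ i : Fin N, ((if i.val = 0 then ∫ x, (T * partialP i (partialP i F) x - x.2 i *
        partialP i F x) * (G x * χ n x) * P.gibbsDensity N T x else 0) +
        (if i.val = N - 1 then ∫ x, (T * partialP i (partialP i F) x - x.2 i *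
          partialP i F x) * (G x * χ n x) * P.gibbsDensity N T x else 0)) := by
    intro n
    have hsplit : (fun x => (∑ i : Fin N,
        ((if i.val = 0 then T * partialP i (partialP i F) x - x.2 i * partialP i F x else 0) +
        (if i.val = N - 1 then T * partialP i (partialP i F) x - x.2 i * partialP i F x else 0))) *
        (G x * χ n x) * P.gibbsDensity N T x) = fun x => ∑ i : Fin N,
        ((if i.val = 0 then T * partialP i (partialP i F) x - x.2 i * partialP i F x else 0) *
          (G x * χ n x) * P.gibbsDensity N T x +
        (if i.val = N - 1 then T * partialP i (partialP i F) x - x.2 i * partialP i F x else 0) *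
          (G x * χ n x) * P.gibbsDensity N T x) := by
      funext x
      simp only [Finset.sum_mul, add_mul]
    have IsiteSum : ∀ i : Fin N, Integrable fun x =>
        (if i.val = 0 then T * partialP i (partialP i F) x - x.2 i * partialP i F x else 0) *
          (G x * χ n x) * P.gibbsDensity N T x +
        (if i.val = N - 1 then T * partialP i (partialP i F) x - x.2 i * partialP i F x else 0) *
          (G x * χ n x) * P.gibbsDensity N T x := fun i => (Isite n i _).add (Isite n i _)
    rw [hsplit, integral_finsetSum _ fun i _ => IsiteSum i]
    refine Finset.sum_congr rfl fun i _ => ?_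
    rw [integral_add (Isite n i _) (Isite n i _), Vsite, Vsite]
  -- Step 2: the left-hand sides converge (dominated by `|K G ρ|`)
  have lim1 : Tendsto (fun n => ∫ x, (∑ i : Fin N,
      ((if i.val = 0 then T * partialP i (partialP i F) x - x.2 i * partialP i F x else 0) +
        (if i.val = N - 1 then T * partialP i (partialP i F) x - x.2 i * partialP i F x else 0))) *
      (G x * χ n x) * P.gibbsDensity N T x) atTop (𝓝 (∫ x, (∑ i : Fin N,
      ((if i.val = 0 then T * partialP i (partialP i F) x - x.2 i * partialP i F x else 0) +
        (if i.val = N - 1 then T * partialP i (partialP i F) x - x.2 i * partialP i F x else 0))) *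
      G x * P.gibbsDensity N T x)) := by
    refine tendsto_integral_of_dominated_convergence _ (fun n => ?_) hK.norm
      (fun n => Filter.Eventually.of_forall fun x => ?_) (Filter.Eventually.of_forall fun x => ?_)
    · exact (hK.aestronglyMeasurable.mul (hχ1 n).continuous.aestronglyMeasurable).congr
        (Filter.Eventually.of_forall fun x => by simp only [Pi.mul_apply]; ring)
    · have hχa : |χ n x| ≤ 1 := abs_le.2 ⟨by linarith [hχ3 n x], hχ4 n x⟩
      rw [Real.norm_eq_abs, Real.norm_eq_abs]
      rw [show ∀ K : ℝ, K * (G x * χ n x) * P.gibbsDensity N T x =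
        (K * G x * P.gibbsDensity N T x) * χ n x from fun K => by ring, abs_mul]
      exact (mul_le_mul_of_nonneg_left hχa (abs_nonneg _)).trans (le_of_eq (mul_one _))
    · have h1 : Tendsto (fun n => χ n x) atTop (𝓝 1) :=
        tendsto_const_nhds.congr' ((hχ5 x).mono fun n hn => hn.symm)
      have h3 := ((h1.const_mul (G x)).const_mul (∑ i : Fin N,
        ((if i.val = 0 then T * partialP i (partialP i F) x - x.2 i * partialP i F x else 0) +
        (if i.val = N - 1 then T * partialP i (partialP i F) x - x.2 i * partialP i F x else 0))))
        |>.mul_const (P.gibbsDensity N T x)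
      simpa using h3
  -- Step 3: the right-hand sides converge site by site
  have site := fun i : Fin N => tendsto_integral_bathSite_mul_cutoff hω hl hβ γ N hT hθ i hF hG
    (fun x => hFp x i) hGle (fun x => hGp x i) hχ1 hχ2 hχ3 hχ4 hχ5 hχ6
  have lim2 : Tendsto (fun n => ∑ i : Fin N, ((if i.val = 0 then ∫ x, (T * partialP i
      (partialP i F) x - x.2 i * partialP i F x) * (G x * χ n x) * P.gibbsDensity N T x else 0) +
        (if i.val = N - 1 then ∫ x, (T * partialP i (partialP i F) x - x.2 i *
          partialP i F x) * (G x * χ n x) * P.gibbsDensity N T x else 0))) atTop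
      (𝓝 (∑ i : Fin N, ((if i.val = 0 then -T * ∫ x, partialP i F x * partialP i G x *
          P.gibbsDensity N T x else 0) +
        (if i.val = N - 1 then -T * ∫ x, partialP i F x * partialP i G x *
          P.gibbsDensity N T x else 0)))) := by
    refine tendsto_finsetSum _ fun i _ => Tendsto.add ?_ ?_
    · by_cases h0 : i.val = 0
      · simp only [h0, if_true]; exact site i
      · simp only [h0, if_false]; exact tendsto_const_nhds
    · by_cases h1 : i.val = N - 1
      · simp only [h1, if_true]; exact site i
      · simp only [h1, if_false]; exact tendsto_const_nhds
  -- Step 4: identify the limits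
  have lim1' := lim1.congr key
  rw [tendsto_nhds_unique lim1' lim2, Finset.mul_sum]
  refine Finset.sum_congr rfl fun i _ => ?_
  split_ifs <;> ring

end Pinned

end Summit.AtomisticToContinuum.FouriersLaw.Theorems.ThomsonBound

end
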